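import Summits.AnomalousDissipation.AnomalousDissipation.Theses.PumpedMirror
import Summits.AnomalousDissipation.AnomalousDissipation.Theorems.PumpedMirrorNoSmoothMirrorDodgerTGSkeleton
import Summits.AnomalousDissipation.AnomalousDissipation.Theorems.MirrorStatisticsLoudTG.Negative.LoadBearing

/-!
# `PumpedMirror.NoSmoothMirrorDodgerTG` (stmt-AnomalousDissipation-15374) and
# `PumpedMirror.KelvinPumpSteadyTG` (stmt-AnomalousDissipation-15375): the Kelvin pump on the skeleton
# loop of the Taylor–Green mirrors

Item `stmt-AnomalousDissipation-15374` (route `PumpedMirror`, support, "provable now, M") is PROVED: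
`noSmoothMirrorDodgerTG : Theses.PumpedMirror.NoSmoothMirrorDodgerTG` — for the Taylor–Green force
`f_TG = (sin2πx₀ cos2πx₁ cos2πx₂, −cos2πx₀ sin2πx₁ cos2πx₂, 0)` there is NO smooth divergence-free
field `v` on `T³`, odd under the three coordinate mirrors `K` (`vⱼ(σᵢx) = ∓vⱼ(x)`), with
`∫ ⟪(v·∇)v − f_TG, w⟫ = 0` for every smooth divergence-free mean-zero test field `w`
(no smooth K-symmetric steady weak Euler state: the `ν = 0` end of the mirror-class programme of the
routes `PumpedMirror`, `SteadyMirrorGate` (`NoMirrorDodgerTG` is its `H¹` version), `PumpSignGate`,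
`ErgodicMirrorGate`).

Proof (the KELVIN PUMP on the skeleton loop; Brachet et al. 1983, §2 — the impermeable box of the TG
symmetries; Kelvin's circulation theorem in the steady forced form):
* §2 weak ⇒ strong: `(v·∇)v + ∇p = f_TG` pointwise with a smooth pressure `p` (de Rham on `T³` via the
  smooth Helmholtz–Weyl decomposition `Torus.smooth_helmholtz_holds`; the argument of the landed
  `SmoothEulerCoerciveForce.Helical.stub_strongForm`, inlined here because that module is not built on
  the checking farm);
* §3 on a coordinate segment `γ(s) = a + s eτ` lying in the intersection of two mirror planes the normal
  components of `v` vanish (`K`-oddness), so `((v·∇)v)τ ∘ γ = ∂ₛ (vτ∘γ)²/2` and `(∇p)τ ∘ γ = ∂ₛ (p ∘ γ)`;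
  if moreover `vτ` vanishes at `γ(0)` and `γ(½)` (the vertices of the box, fixed by the third mirror), the
  fundamental theorem of calculus gives `∫₀^{1/2} (f_TG)τ(γ(s)) ds = p(γ(½)) − p(γ(0))`;
* §4–§6 summing over the four edges of `C = ∂([0,½]² × {x₂ = 0})` the pressure telescopes to `0`, while
  the circulation of `f_TG` around `C` is `4/π` (`tg_loop_circulation`, each edge contributes
  `∫₀^{1/2} sin 2πs ds = 1/π`): contradiction (`noSmoothMirrorDodgerTG`).
* §7 the RUNG in the currency of the crux `SteadyMirrorGate.NoMirrorDodgerTG` (stmt-AnomalousDissipation-33832,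
  the `H¹` version): `noMirrorDodgerTG_smoothSolenoidal` — the crux with its binders verbatim, restricted to
  the smooth solenoidal class `𝒱 = Torus.smoothSolenoidal` (a.e. `K`-oddness is transported to the smooth
  representative along the measure-preserving reflections; `∫ (v ⊗ v) : ∇w = −∫ ⟪(v·∇)v, w⟫`).
* §8 item `stmt-AnomalousDissipation-15375` (`PumpedMirror.KelvinPumpSteadyTG`, support, "provable now, M"):
  `kelvinPumpSteadyTG` — for every `ν` and every smooth `K`-odd steady classical state `(u, p)` of
  `NS_ν(f_TG)`, `ν ∮_C Δu · dl = −4/π` (the same edge lemma with right-hand side `ν Δu + f_TG`).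

References: M. E. Brachet, D. I. Meiron, S. A. Orszag, B. G. Nickel, R. H. Morf, U. Frisch, *Small-scale
structure of the Taylor–Green vortex*, J. Fluid Mech. 130 (1983) 411–452, §2 [doi:10.1017/s0022112083001159];
J. C. Robinson, J. L. Rodrigo, W. Sadowski, *The three-dimensional Navier–Stokes equations* (CUP 2016),
Thm. 2.6 (Helmholtz–Weyl on the torus) [RobinsonRodrigoSadowski2016].

TREE LANDING NOTE (decomp-ad census-1 g20, landing lane): the certified landable of decomp-ad lens-6 g61
(`PumpedMirrorNoSmoothMirrorDodgerTG.lean`, sha256 6e267eb7354f0641…, 746 lines, farm rc 0 / 0 sorry / axioms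
standard) exceeds the gate's 400-line limit for Theorems files with proofs (`lint.statement-form`), so it is
landed as TWO modules in the original order: `…Theorems.PumpedMirrorNoSmoothMirrorDodgerTGSkeleton` (§1, §3–§6;
§2 = the landed `SmoothEulerCoerciveForce.Helical.stub_strongForm`, imported there per the gate's `dedup.landed`)
→ this one (§7–§8: the rung and the two items); and the gate's `dedup.landed` identified §7's inlined
`measurePreserving_reflect` with the landed `MirrorStatisticsLoudTG.Negative.measurePreserving_reflect`, so that copy is
deleted and the landed one is imported and `open`ed under the same short name (identical statement; use sites unchanged).
All other declarations of §7–§8 byte-identical to the landable.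
-/

-- every `Summit.AnomalousDissipation.AnomalousDissipation.…` name repeats the summit = problem segment (tree layout)
set_option linter.dupNamespace false

noncomputable section

open MeasureTheory
open scoped InnerProductSpace
open Literature.Analysis.FunctionSpaces Literature.Analysis.FunctionSpaces.Torus
open Summit.AnomalousDissipation.AnomalousDissipation.Theorems.TaylorGreenLoudGalerkinStates.Negative
  (tgForce isSmooth_tgForce isDivFree_tgForce hasZeroMean_tgForce)

namespace Summit.AnomalousDissipation.AnomalousDissipation.Theorems.PumpedMirrorNoSmoothMirrorDodgerTG

/-! ## §7 The rung in the currency of `SteadyMirrorGate.NoMirrorDodgerTG` (the smooth solenoidal class)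
and item `stmt-AnomalousDissipation-15374`

`SteadyMirrorGate.NoMirrorDodgerTG` (stmt-AnomalousDissipation-33832) excludes every finite-enstrophy
`K`-supported steady `H`-weak Euler state of `f_TG`. Its restriction to the smooth solenoidal class
`𝒱 = Torus.smoothSolenoidal` — states of `H` with a smooth divergence-free mean-zero representative —
is a theorem: `noMirrorDodgerTG_smoothSolenoidal` (same binders as the crux plus `v ∈ 𝒱`). -/

-- `measurePreserving_reflect` (the coordinate reflection `σᵢ` preserves Haar measure on `T³`) is the landed
-- `MirrorStatisticsLoudTG.Negative.measurePreserving_reflect`, imported (gate `dedup.landed`; the g61 landable inlined it).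
open Summit.AnomalousDissipation.AnomalousDissipation.Theorems.MirrorStatisticsLoudTG.Negative (measurePreserving_reflect)

/-- The coordinate reflection `σᵢ` is continuous. [folklore] -/
theorem continuous_reflect (i : Fin 3) :
    Continuous (fun x : UnitAddTorus (Fin 3) => Function.update x i (-x i)) :=
  continuous_id.update i (continuous_apply i).neg

/-- Almost-everywhere `K`-oddness of a field with a continuous representative is pointwise `K`-oddness
of the representative (transport along the measure-preserving reflection, then continuity on a torus of
full support). [folklore] -/
theorem kOdd_of_ae_kOdd {u v : UnitAddTorus (Fin 3) → EuclideanSpace ℝ (Fin 3)} (hv : Continuous v)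
    (huv : u =ᵐ[volume] v)
    (hK : ∀ i j : Fin 3, (fun x => u (Function.update x i (-x i)) j) =ᵐ[volume]
      (fun x => if j = i then -(u x j) else u x j)) :
    ∀ (i j : Fin 3) (x : UnitAddTorus (Fin 3)),
      v (Function.update x i (-x i)) j = if j = i then -(v x j) else v x j := by
  intro i j
  have h1 : (fun x => u (Function.update x i (-x i)) j) =ᵐ[volume]
      (fun x => v (Function.update x i (-x i)) j) :=
    ((measurePreserving_reflect i).quasiMeasurePreserving.ae_eq_comp huv).mono fun x hx => by
      simpa using congrArg (fun w : EuclideanSpace ℝ (Fin 3) => w j) hx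
  have h2 : (fun x => if j = i then -(u x j) else u x j) =ᵐ[volume]
      (fun x => if j = i then -(v x j) else v x j) :=
    huv.mono fun x hx => by simp only [hx]
  have h3 := (h1.symm.trans (hK i j)).trans h2
  have hL : Continuous (fun x => v (Function.update x i (-x i)) j) :=
    ((EuclideanSpace.proj j : EuclideanSpace ℝ (Fin 3) →L[ℝ] ℝ).continuous).comp
      (hv.comp (continuous_reflect i))
  have hvj : Continuous (fun x => v x j) :=
    ((EuclideanSpace.proj j : EuclideanSpace ℝ (Fin 3) →L[ℝ] ℝ).continuous).comp hv
  have hR : Continuous (fun x => if j = i then -(v x j) else v x j) := by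
    by_cases hji : j = i
    · subst hji
      simp only [if_true]
      exact hvj.neg
    · simp only [hji, if_false]
      exact hvj
  exact congrFun ((Continuous.ae_eq_iff_eq volume hL hR).1 h3)

/-- Pointwise `K`-oddness of a representative is almost-everywhere `K`-oddness of the class (the
converse transport of `kOdd_of_ae_kOdd`). [folklore] -/
theorem ae_kOdd_of_kOdd {u v : UnitAddTorus (Fin 3) → EuclideanSpace ℝ (Fin 3)} (huv : u =ᵐ[volume] v)
    (hK : ∀ (i j : Fin 3) (x : UnitAddTorus (Fin 3)),
      v (Function.update x i (-x i)) j = if j = i then -(v x j) else v x j) :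
    ∀ i j : Fin 3, (fun x => u (Function.update x i (-x i)) j) =ᵐ[volume]
      (fun x => if j = i then -(u x j) else u x j) := by
  intro i j
  have h1 : (fun x => u (Function.update x i (-x i)) j) =ᵐ[volume]
      (fun x => v (Function.update x i (-x i)) j) :=
    ((measurePreserving_reflect i).quasiMeasurePreserving.ae_eq_comp huv).mono fun x hx => by
      simpa using congrArg (fun w : EuclideanSpace ℝ (Fin 3) => w j) hx
  have h2 : (fun x => v (Function.update x i (-x i)) j) =ᵐ[volume]
      (fun x => if j = i then -(v x j) else v x j) :=
    Filter.Eventually.of_forall fun x => hK i j x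
  have h3 : (fun x => if j = i then -(v x j) else v x j) =ᵐ[volume]
      (fun x => if j = i then -(u x j) else u x j) :=
    huv.mono fun x hx => by simp only [hx]
  exact (h1.trans h2).trans h3

/-- A continuous `K`-odd field has zero mean: each component `v_j` is odd under the measure-preserving
reflection `σ_j`, so `∫ v_j = −∫ v_j`. [folklore] -/
theorem hasZeroMean_of_kOdd {v : UnitAddTorus (Fin 3) → EuclideanSpace ℝ (Fin 3)} (hv : Continuous v)
    (hK : ∀ (i j : Fin 3) (x : UnitAddTorus (Fin 3)),
      v (Function.update x i (-x i)) j = if j = i then -(v x j) else v x j) :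
    HasZeroMean v := by
  unfold HasZeroMean
  have hint : Integrable v volume :=
    hv.integrable_of_hasCompactSupport (HasCompactSupport.of_compactSpace v)
  refine PiLp.ext fun j => ?_
  have hvj : Continuous (fun x => v x j) :=
    ((EuclideanSpace.proj j : EuclideanSpace ℝ (Fin 3) →L[ℝ] ℝ).continuous).comp hv
  have hj : (∫ x, v x) j = ∫ x, v x j :=
    ((EuclideanSpace.proj j : EuclideanSpace ℝ (Fin 3) →L[ℝ] ℝ).integral_comp_comm hint).symm
  have hσ := measurePreserving_reflect j
  have h1 : ∫ x, v (Function.update x j (-x j)) j = ∫ x, v x j := by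
    have h := integral_map hσ.measurable.aemeasurable (f := fun x => v x j)
      (by rw [hσ.map_eq]; exact hvj.aestronglyMeasurable)
    rw [hσ.map_eq] at h
    exact h.symm
  have h2 : ∫ x, v (Function.update x j (-x j)) j = -∫ x, v x j := by
    have hfun : (fun x => v (Function.update x j (-x j)) j) = fun x => -(v x j) := by
      funext x
      rw [hK j j, if_pos rfl]
    rw [hfun]
    exact integral_neg _
  have h0 : ∫ x, v x j = 0 := by linarith
  rw [hj, h0, PiLp.zero_apply]

/-- The inertial pairing of an `L²` class with a smooth divergence-free representative `v` against a
smooth field `w`: `∫ (v ⊗ v) : ∇w = −∫ ⟪(v·∇)v, w⟫` (Temam's antisymmetry,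
`Torus.integral_inner_convect_eq_neg`). [folklore] -/
theorem inertialPairing_of_ae_eq
    (U : Lp (EuclideanSpace ℝ (Fin 3)) 2 (volume : Measure (UnitAddTorus (Fin 3))))
    {v : UnitAddTorus (Fin 3) → EuclideanSpace ℝ (Fin 3)} (hvs : IsSmooth v) (hvd : IsDivFree v)
    (hUv : (U : UnitAddTorus (Fin 3) → EuclideanSpace ℝ (Fin 3)) =ᵐ[volume] v)
    {w : UnitAddTorus (Fin 3) → EuclideanSpace ℝ (Fin 3)} (hw : IsSmooth w) :
    Literature.Analysis.FluidPDE.Torus.inertialPairing U w = -∫ x, ⟪Torus.convect v v x, w x⟫_ℝ := by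
  unfold Literature.Analysis.FluidPDE.Torus.inertialPairing
  have hae : (fun x => ⟪Torus.fderiv w x ((U : UnitAddTorus (Fin 3) → EuclideanSpace ℝ (Fin 3)) x),
      (U : UnitAddTorus (Fin 3) → EuclideanSpace ℝ (Fin 3)) x⟫_ℝ) =ᵐ[volume]
      (fun x => ⟪v x, Torus.convect v w x⟫_ℝ) :=
    hUv.mono fun x hx => by
      simp only [hx, Torus.convect]
      exact real_inner_comm _ _
  rw [integral_congr_ae hae]
  have h3 := Torus.integral_inner_convect_eq_neg hvs hvd hvs hw
  linarith

/-- A steady `H`-weak Euler state (`Torus.IsSteadyWeakSolution 0 f`) with a smooth divergence-free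
representative `v` is a smooth quiet Euler point: `∫ ⟪(v·∇)v − f, w⟫ = 0` for all smooth
divergence-free mean-zero `w`. [folklore] -/
theorem quiet_of_isSteadyWeakSolution {f : UnitAddTorus (Fin 3) → EuclideanSpace ℝ (Fin 3)}
    (hf : IsSmooth f) (U : ↥(Torus.energySpace (Fin 3)))
    {v : UnitAddTorus (Fin 3) → EuclideanSpace ℝ (Fin 3)} (hvs : IsSmooth v) (hvd : IsDivFree v)
    (hUv : ((U : Lp (EuclideanSpace ℝ (Fin 3)) 2 (volume : Measure (UnitAddTorus (Fin 3)))) :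
      UnitAddTorus (Fin 3) → EuclideanSpace ℝ (Fin 3)) =ᵐ[volume] v)
    (hsol : Literature.Analysis.FluidPDE.Torus.IsSteadyWeakSolution 0 f U) :
    ∀ w : UnitAddTorus (Fin 3) → EuclideanSpace ℝ (Fin 3), IsSmooth w → IsDivFree w →
      HasZeroMean w → ∫ x, inner ℝ (Torus.convect v v x - f x) (w x) = 0 := by
  intro w hw hwd hwz
  have h := hsol w hw hwd hwz
  unfold Literature.Analysis.FluidPDE.Torus.nsGeneratorPairing at h
  rw [zero_mul, add_zero, inertialPairing_of_ae_eq _ hvs hvd hUv hw] at h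
  have i1 : Integrable (fun x => ⟪Torus.convect v v x, w x⟫_ℝ) volume :=
    ((hvs.convect hvs).inner hw).integrable
  have i2 : Integrable (fun x => ⟪f x, w x⟫_ℝ) volume := (hf.inner hw).integrable
  simp_rw [inner_sub_left]
  rw [integral_sub i1 i2]
  linarith

/-- Conversely, the `H`-class of a smooth divergence-free quiet Euler point is a steady `H`-weak Euler
state. [folklore] -/
theorem isSteadyWeakSolution_of_quiet {f : UnitAddTorus (Fin 3) → EuclideanSpace ℝ (Fin 3)}
    (hf : IsSmooth f) (U : ↥(Torus.energySpace (Fin 3)))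
    {v : UnitAddTorus (Fin 3) → EuclideanSpace ℝ (Fin 3)} (hvs : IsSmooth v) (hvd : IsDivFree v)
    (hUv : ((U : Lp (EuclideanSpace ℝ (Fin 3)) 2 (volume : Measure (UnitAddTorus (Fin 3)))) :
      UnitAddTorus (Fin 3) → EuclideanSpace ℝ (Fin 3)) =ᵐ[volume] v)
    (hq : ∀ w : UnitAddTorus (Fin 3) → EuclideanSpace ℝ (Fin 3), IsSmooth w → IsDivFree w →
      HasZeroMean w → ∫ x, inner ℝ (Torus.convect v v x - f x) (w x) = 0) :
    Literature.Analysis.FluidPDE.Torus.IsSteadyWeakSolution 0 f U := by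
  intro w hw hwd hwz
  unfold Literature.Analysis.FluidPDE.Torus.nsGeneratorPairing
  rw [zero_mul, add_zero, inertialPairing_of_ae_eq _ hvs hvd hUv hw]
  have h := hq w hw hwd hwz
  have i1 : Integrable (fun x => ⟪Torus.convect v v x, w x⟫_ℝ) volume :=
    ((hvs.convect hvs).inner hw).integrable
  have i2 : Integrable (fun x => ⟪f x, w x⟫_ℝ) volume := (hf.inner hw).integrable
  simp_rw [inner_sub_left] at h
  rw [integral_sub i1 i2] at h
  linarith

/-- **`NoMirrorDodgerTG` on the smooth solenoidal class (rung).** For the Taylor–Green force, no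
`v ∈ H` with a smooth divergence-free mean-zero representative (`v ∈ 𝒱 = Torus.smoothSolenoidal`), of
finite enstrophy and `K`-odd almost everywhere, is a steady `H`-weak Euler state — the crux
`SteadyMirrorGate.NoMirrorDodgerTG` (stmt-AnomalousDissipation-33832) with its binders verbatim plus the
class hypothesis `v ∈ 𝒱`. [folklore] -/
theorem noMirrorDodgerTG_smoothSolenoidal :
    ∀ f : UnitAddTorus (Fin 3) → EuclideanSpace ℝ (Fin 3), f = (fun x => !₂[(fourier 1 (x 0) : ℂ).im *
      (fourier 1 (x 1) : ℂ).re * (fourier 1 (x 2) : ℂ).re, -((fourier 1 (x 0) : ℂ).re * (fourier 1 (x 1) : ℂ).im *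
      (fourier 1 (x 2) : ℂ).re), (0 : ℝ)]) →
    ∀ v : ↥(Literature.Analysis.FunctionSpaces.Torus.energySpace (Fin 3)),
      (v : MeasureTheory.Lp (EuclideanSpace ℝ (Fin 3)) 2
        (MeasureTheory.volume : MeasureTheory.Measure (UnitAddTorus (Fin 3)))) ∈
          Literature.Analysis.FunctionSpaces.Torus.smoothSolenoidal (Fin 3) →
      (v : MeasureTheory.Lp (EuclideanSpace ℝ (Fin 3)) 2
        (MeasureTheory.volume : MeasureTheory.Measure (UnitAddTorus (Fin 3)))) ∈
          Literature.Analysis.FunctionSpaces.Torus.energySpaceV (Fin 3) →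
      (∀ i j : Fin 3, (fun x => ((v : MeasureTheory.Lp (EuclideanSpace ℝ (Fin 3)) 2
          (MeasureTheory.volume : MeasureTheory.Measure (UnitAddTorus (Fin 3)))) :
            UnitAddTorus (Fin 3) → EuclideanSpace ℝ (Fin 3)) (Function.update x i (-x i)) j) =ᵐ[MeasureTheory.volume]
        (fun x => if j = i then -(((v : MeasureTheory.Lp (EuclideanSpace ℝ (Fin 3)) 2
          (MeasureTheory.volume : MeasureTheory.Measure (UnitAddTorus (Fin 3)))) :
            UnitAddTorus (Fin 3) → EuclideanSpace ℝ (Fin 3)) x j)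
          else ((v : MeasureTheory.Lp (EuclideanSpace ℝ (Fin 3)) 2
            (MeasureTheory.volume : MeasureTheory.Measure (UnitAddTorus (Fin 3)))) :
              UnitAddTorus (Fin 3) → EuclideanSpace ℝ (Fin 3)) x j)) →
      ¬ Literature.Analysis.FluidPDE.Torus.IsSteadyWeakSolution 0 f v := by
  intro f hf v hsm _ hK hsol
  have hft : f = tgForce := hf
  subst hft
  obtain ⟨u, hus, hud, -, huv⟩ := hsm
  exact no_smooth_mirror_euler_state u hus hud (kOdd_of_ae_kOdd hus.continuous huv hK)
    (quiet_of_isSteadyWeakSolution isSmooth_tgForce v hus hud huv hsol)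

/-- **Item `stmt-AnomalousDissipation-15374` (`PumpedMirror.NoSmoothMirrorDodgerTG`), proved** — through the
rung: the `L²` class of a smooth divergence-free `K`-odd quiet Euler point lies in `𝒱 ⊆ V ⊆ H`
(`K`-oddness gives zero mean), is `K`-odd almost everywhere and is a steady `H`-weak Euler state, which
`noMirrorDodgerTG_smoothSolenoidal` excludes. [folklore] -/
theorem noSmoothMirrorDodgerTG :
    Summit.AnomalousDissipation.AnomalousDissipation.Theses.PumpedMirror.NoSmoothMirrorDodgerTG := by
  intro f hf v hvs hvd hK hq
  have hft : f = tgForce := hf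
  subst hft
  set U : Lp (EuclideanSpace ℝ (Fin 3)) 2 (volume : Measure (UnitAddTorus (Fin 3))) :=
    (hvs.memLp 2).toLp v with hU
  have hUv : (U : UnitAddTorus (Fin 3) → EuclideanSpace ℝ (Fin 3)) =ᵐ[volume] v :=
    MemLp.coeFn_toLp _
  have hmem : U ∈ Torus.smoothSolenoidal (Fin 3) :=
    ⟨v, hvs, hvd, hasZeroMean_of_kOdd hvs.continuous hK, hUv⟩
  have hH : U ∈ Torus.energySpace (Fin 3) := Torus.smoothSolenoidal_subset_energySpace hmem
  have hV : U ∈ Torus.energySpaceV (Fin 3) := Torus.smoothSolenoidal_subset_energySpaceV_holds hmem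
  exact noMirrorDodgerTG_smoothSolenoidal tgForce hf ⟨U, hH⟩ hmem hV (ae_kOdd_of_kOdd hUv hK)
    (isSteadyWeakSolution_of_quiet isSmooth_tgForce ⟨U, hH⟩ hvs hvd hUv hq)

/-! ## §8 Item `stmt-AnomalousDissipation-15375` (`PumpedMirror.KelvinPumpSteadyTG`): the viscous
Kelvin identity `ν ∮_C Δu · dl = −4/π` for steady mirror-symmetric classical states -/

/-- Splitting an edge integral of `ν Δu + f` into its viscous and forcing parts (both integrands are
continuous along the edge). [folklore] -/
theorem edge_integral_split {u f : UnitAddTorus (Fin 3) → EuclideanSpace ℝ (Fin 3)} (hu : IsSmooth u)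
    (hf : Continuous f) (ν : ℝ) (a : EuclideanSpace ℝ (Fin 3)) (τ : Fin 3) (γ : ℝ → UnitAddTorus (Fin 3))
    (hγ : ∀ s, γ s = proj (a + s • EuclideanSpace.single τ 1)) :
    ∫ s in (0 : ℝ)..(1 / 2), (ν • Torus.laplacian u (γ s) + f (γ s)) τ =
      ν * (∫ s in (0 : ℝ)..(1 / 2), Torus.laplacian u (γ s) τ) + ∫ s in (0 : ℝ)..(1 / 2), f (γ s) τ := by
  obtain rfl : γ = fun s => proj (a + s • EuclideanSpace.single τ 1) := funext hγ
  have hL : Continuous (fun s : ℝ => Torus.laplacian u (proj (a + s • EuclideanSpace.single τ 1)) τ) :=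
    continuous_line_apply hu.laplacian.continuous a _ τ
  have hF : Continuous (fun s : ℝ => f (proj (a + s • EuclideanSpace.single τ 1)) τ) :=
    continuous_line_apply hf a _ τ
  simp only [PiLp.add_apply, PiLp.smul_apply, smul_eq_mul]
  rw [intervalIntegral.integral_add ((hL.const_mul ν).intervalIntegrable _ _) (hF.intervalIntegrable _ _),
    intervalIntegral.integral_const_mul]

/-- **Item `stmt-AnomalousDissipation-15375` (`PumpedMirror.KelvinPumpSteadyTG`), proved.** For every `ν`
and every smooth `K`-odd steady classical state `(u, p)` of `NS_ν(f_TG)` on `T³` the viscous circulation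
around the skeleton loop is pinned: `ν ∮_C Δu · dl = −∮_C f_TG · dl = −4/π`. Proof: the steady momentum
equation reads `(u·∇)u + ∇p = ν Δu + f_TG`; apply the edge lemma with the continuous right-hand side
`ν Δu + f_TG` on the four edges (tangency and vertex vanishing from `K`-oddness), telescope the pressure,
and subtract the Kelvin datum `∮_C f_TG · dl = 4/π`. [folklore] -/
theorem kelvinPumpSteadyTG :
    Summit.AnomalousDissipation.AnomalousDissipation.Theses.PumpedMirror.KelvinPumpSteadyTG := by
  intro f hf ν u p hsol hK
  have hft : f = tgForce := hf
  subst hft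
  have hus : IsSmooth u := hsol.smooth_velocity.isSmooth_slice (t := 0) (Set.mem_univ _)
  have hps : IsSmooth p := hsol.smooth_pressure.isSmooth_slice (t := 0) (Set.mem_univ _)
  have hE : ∀ x, Torus.convect u u x + Torus.gradient p x =
      (fun y => ν • Torus.laplacian u y + tgForce y) x := by
    intro x
    have hm := hsol.momentum 0 (Set.mem_univ _) x
    have ht : Torus.timeDerivWithin Set.univ (fun _ : ℝ => u) 0 x = 0 := by
      simp [Torus.timeDerivWithin]
    rw [ht, zero_add] at hm
    rw [hm]
    abel
  have hgc : Continuous (fun y => ν • Torus.laplacian u y + tgForce y) :=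
    (hus.laplacian.continuous.const_smul ν).add isSmooth_tgForce.continuous
  obtain ⟨⟨n1, a1, b1⟩, ⟨n2, a2, b2⟩, ⟨n3, a3, b3⟩, ⟨n4, a4, b4⟩⟩ := mirror_edge_conditions hK
  have e1 := edge_integral hus hps hgc hE 0 0 edge₁ edge₁_eq n1 a1 b1
  have e2 := edge_integral hus hps hgc hE _ 1 edge₂ edge₂_eq n2 a2 b2
  have e3 := edge_integral hus hps hgc hE _ 0 edge₃ edge₃_eq n3 a3 b3
  have e4 := edge_integral hus hps hgc hE 0 1 edge₄ edge₄_eq n4 a4 b4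
  rw [edge_integral_split hus isSmooth_tgForce.continuous ν 0 0 edge₁ edge₁_eq] at e1
  rw [edge_integral_split hus isSmooth_tgForce.continuous ν _ 1 edge₂ edge₂_eq] at e2
  rw [edge_integral_split hus isSmooth_tgForce.continuous ν _ 0 edge₃ edge₃_eq] at e3
  rw [edge_integral_split hus isSmooth_tgForce.continuous ν 0 1 edge₄ edge₄_eq] at e4
  have hloop := tg_loop_circulation
  obtain ⟨c12, c23, c43, c41⟩ := edges_close
  rw [c12, c23] at e2
  rw [c43, c41] at e4
  show ν * ((∫ s in (0 : ℝ)..(1 / 2), Torus.laplacian u (edge₁ s) 0) +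
      (∫ s in (0 : ℝ)..(1 / 2), Torus.laplacian u (edge₂ s) 1) -
      (∫ s in (0 : ℝ)..(1 / 2), Torus.laplacian u (edge₃ s) 0) -
      (∫ s in (0 : ℝ)..(1 / 2), Torus.laplacian u (edge₄ s) 1)) = -(4 / Real.pi)
  linarith

end Summit.AnomalousDissipation.AnomalousDissipation.Theorems.PumpedMirrorNoSmoothMirrorDodgerTG

end
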